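import Literature.NumberTheory.Sieve.FGKMT2018SievingPrimes
import Literature.NumberTheory.LFunctions.MertensTail
import Literature.NumberTheory.LFunctions.ExceptionalPrimesWindows
import HarnessLib

/-!
# Ford–Green–Konyagin–Maynard–Tao 2018 — §6 (6.8)–(6.9): the density `σ` of the sifted set
# `S(a⃗)`, `σ = (1 + o(1)) 80 log₂² x / (log x log₃ x)` and `σ y = (1 + o(1)) 80 c x log₂ x` (PROVED)

Topic `Literature/NumberTheory/Sieve`. Source: K. Ford, B. Green, S. Konyagin, J. Maynard, T. Tao,
*Long gaps between primes*, J. Amer. Math. Soc. 31 (2018) 65–105 = arXiv:1412.5029, §6 p. 17,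
displays (6.8)–(6.9) [FordGreenKonyaginMaynardTao2018]:
«The resulting sifted set `S(a⃗)` is a random periodic subset of `ℤ` with density
`σ := ∏_{s ∈ 𝒮} (1 − 1/s)`. From the prime number theorem (with sufficiently strong error term),
(3.2) and (3.3), `σ = (1 + O(1/log₂^{10} x)) log(log^{20} x)/log z = (1 + O(1/log₂^{10} x))
80 log₂ x / (log x log₃ x / log₂ x)`, so in particular we see from (3.1) that
`σ y = (1 + O(1/log₂^{10} x)) 80 c x log₂ x` (6.9).»

This file PROVES the two-sided bound with the elementary (Chebyshev–Mertens) error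
`exp(±1/log₂ x)` in place of the paper's `1 + O(log₂^{-10} x)` — which is all that the deduction
of Theorem 4 from Theorem 5 in §6 uses (the constant `C = (u/σ)(x/2y) ≍ 1/c` of (4.29) and the
bound `#(𝒬 ∩ S(a⃗)) ≤ 100 c x log₂ x / log x` of (4.27); the fine error terms of §6 come from
Lemma 6.1, where `σ^t` cancels exactly). Inputs: the tree's window Mertens bounds
`MertensBound.loglog_sub_loglog_le_sum_inv_prime` (`MertensTail.lean`) and
`SiegelZero.sum_inv_prime_window_le` (`ExceptionalPrimesWindows.lean`) [HardyWright2008, Thm 427].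

## Main statements (namespace `Literature.NumberTheory.Sieve.FGKMT2018`)
* `sigma x = ∏_{s ∈ 𝒮(x)} (1 − 1/s)` and `sigmaMain x = 80 log₂² x/(log x log₃ x)`;
  `log_L_div_log_z : log(log^{20} x)/log z = sigmaMain x`.
* `sigma_le_exp`, `exp_le_sigma` — explicit two-sided bounds under `2 ≤ log^{20} x ≤ z`.
* `sigma_bounds : ∀ᶠ x, sigmaMain x · e^{−1/log₂ x} ≤ σ(x) ≤ sigmaMain x · e^{1/log₂ x}`;
  `sigma_asymp : ∀ ε > 0, ∀ᶠ x, (1 − ε) sigmaMain x ≤ σ(x) ≤ (1 + ε) sigmaMain x` ((6.8)′);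
  `sigmaMain_mul_ySieve : sigmaMain x · y = 80 c x log₂ x` and `sigma_mul_ySieve_asymp` ((6.9)).
-/

noncomputable section

open Finset Filter

namespace Literature.NumberTheory.Sieve

namespace FGKMT2018

/-! ### Definitions and the trivial bounds -/

/-- `σ = σ(x) := ∏_{s ∈ 𝒮} (1 − 1/s)`, the density of the random sifted set `S(a⃗)`.
[cite: FordGreenKonyaginMaynardTao2018, (6.8) p. 17] -/
def sigma (x : ℕ) : ℝ := ∏ s ∈ primesS x, (1 - 1 / (s : ℝ))

/-- The main term `80 log₂² x / (log x log₃ x) = log(log^{20} x) / log z` of `σ`.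
[cite: FordGreenKonyaginMaynardTao2018, (6.8) p. 17] -/
def sigmaMain (x : ℕ) : ℝ := 80 * (Real.log^[2] x) ^ 2 / (Real.log x * Real.log^[3] x)

/-- `log^[2] t = log log t`. [folklore] -/
private theorem iter_two (t : ℝ) : Real.log^[2] t = Real.log (Real.log t) := by
  simp [Function.iterate_succ_apply']

/-- `log^[3] t = log log log t`. [folklore] -/
private theorem iter_three (t : ℝ) : Real.log^[3] t = Real.log (Real.log (Real.log t)) := by
  simp [Function.iterate_succ_apply']

/-- Membership in `𝒮`. [cite: FordGreenKonyaginMaynardTao2018, (3.3)] -/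
theorem mem_primesS {x s : ℕ} :
    s ∈ primesS x ↔ s.Prime ∧ (Real.log x) ^ 20 < (s : ℝ) ∧ s ≤ ⌊zSieve x⌋₊ := by
  simp only [primesS, Finset.mem_filter, Finset.mem_Icc]
  constructor
  · rintro ⟨⟨_, h2⟩, hp, hL⟩; exact ⟨hp, hL, h2⟩
  · rintro ⟨hp, hL, h2⟩; exact ⟨⟨hp.one_lt.le, h2⟩, hp, hL⟩

/-- [cite: FordGreenKonyaginMaynardTao2018, (6.8) p. 17] -/
theorem two_le_of_mem_primesS {x s : ℕ} (hs : s ∈ primesS x) : (2 : ℝ) ≤ s := by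
  exact_mod_cast (mem_primesS.1 hs).1.two_le

/-- `0 < σ ≤ 1`. [cite: FordGreenKonyaginMaynardTao2018, (6.8) p. 17] -/
theorem sigma_pos (x : ℕ) : 0 < sigma x :=
  Finset.prod_pos fun s hs => by
    have h2 := two_le_of_mem_primesS hs
    have : 1 / (s : ℝ) ≤ 1 / 2 := by
      rw [div_le_div_iff₀ (by linarith) (by norm_num)]; linarith
    linarith

/-- [cite: FordGreenKonyaginMaynardTao2018, (6.8) p. 17] -/
theorem sigma_le_one (x : ℕ) : sigma x ≤ 1 :=
  Finset.prod_le_one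
    (fun s hs => by
      have h2 := two_le_of_mem_primesS hs
      have : 1 / (s : ℝ) ≤ 1 / 2 := by
        rw [div_le_div_iff₀ (by linarith) (by norm_num)]; linarith
      linarith)
    fun s hs => by
      have : 0 ≤ 1 / (s : ℝ) := by positivity
      linarith

/-! ### `𝒮` as a window of primes -/

/-- `𝒮 = {p prime : ⌊log^{20} x⌋ < p ≤ ⌊z⌋}`. [cite: FordGreenKonyaginMaynardTao2018, (3.3)] -/
theorem primesS_eq_Ioc_filter (x : ℕ) :
    primesS x = (Ioc ⌊(Real.log x) ^ 20⌋₊ ⌊zSieve x⌋₊).filter Nat.Prime := by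
  ext s
  rw [mem_primesS, Finset.mem_filter, Finset.mem_Ioc, Nat.floor_lt (pow_nonneg (Real.log_natCast_nonneg x) 20)]
  tauto

/-- `𝒮 = {p ≤ ⌊z⌋ prime : log^{20} x < p}`. [cite: FordGreenKonyaginMaynardTao2018, (3.3)] -/
theorem primesS_eq_primesLE_filter (x : ℕ) :
    primesS x = (Nat.primesLE ⌊zSieve x⌋₊).filter (fun p : ℕ => (Real.log x) ^ 20 < (p : ℝ)) := by
  ext s
  rw [mem_primesS, Finset.mem_filter, Nat.mem_primesLE]
  tauto

/-- `log(log^{20} x) / log z = 80 log₂² x / (log x log₃ x)` (the identity behind (6.8)).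
[cite: FordGreenKonyaginMaynardTao2018, (6.8) p. 17] -/
theorem log_L_div_log_z {x : ℕ} (hx : 1 < x) (hℓ₂ : Real.log^[2] x ≠ 0) :
    Real.log ((Real.log x) ^ 20) / Real.log (zSieve x) = sigmaMain x := by
  have hx0 : (0 : ℝ) < x := by exact_mod_cast (zero_lt_one.trans hx)
  rw [sigmaMain, zSieve, Real.log_rpow hx0, Real.log_pow, iter_two, iter_three]
  rw [iter_two] at hℓ₂
  push_cast
  by_cases hℓ₃ : Real.log (Real.log (Real.log x)) = 0
  · simp [hℓ₃]
  have hℓ : Real.log x ≠ 0 := by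
    intro h; rw [h, Real.log_zero] at hℓ₂; exact hℓ₂ rfl
  field_simp
  ring

/-! ### The explicit two-sided bound -/

/-- `e^{-u} ≤ (1 − u) e^{2u²}` for `0 ≤ u ≤ 1/2` (from `e^{-v} ≤ 1/(1 + v)` with `v = u + 2u²` and
`(1 − u)(1 + u + 2u²) ≥ 1`). [folklore] -/
private theorem exp_neg_le_one_sub_mul_exp {u : ℝ} (hu0 : 0 ≤ u) (hu : u ≤ 1 / 2) :
    Real.exp (-u) ≤ (1 - u) * Real.exp (2 * u ^ 2) := by
  have hv : 0 < 1 + (u + 2 * u ^ 2) := by positivity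
  have h1 : Real.exp (-(u + 2 * u ^ 2)) ≤ 1 / (1 + (u + 2 * u ^ 2)) := by
    rw [Real.exp_neg, one_div]
    exact inv_anti₀ hv (by linarith [Real.add_one_le_exp (u + 2 * u ^ 2)])
  have h2 : 1 / (1 + (u + 2 * u ^ 2)) ≤ 1 - u := by
    rw [div_le_iff₀ hv]; nlinarith
  calc Real.exp (-u) = Real.exp (-(u + 2 * u ^ 2)) * Real.exp (2 * u ^ 2) := by
        rw [← Real.exp_add]; ring_nf
    _ ≤ (1 - u) * Real.exp (2 * u ^ 2) :=
        mul_le_mul_of_nonneg_right (h1.trans h2) (Real.exp_pos _).le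

/-- `exp(−1/s − 2/s²) ≤ 1 − 1/s` for `s ≥ 2`. [cite: FordGreenKonyaginMaynardTao2018, (6.8) p. 17] -/
theorem exp_neg_inv_sub_le {s : ℝ} (hs : 2 ≤ s) :
    Real.exp (-(1 / s) - 2 * (1 / s) ^ 2) ≤ 1 - 1 / s := by
  have hs0 : 0 < s := by linarith
  have hu0 : 0 ≤ 1 / s := by positivity
  have hu : 1 / s ≤ 1 / 2 := by rw [div_le_div_iff₀ hs0 (by norm_num)]; linarith
  have h := exp_neg_le_one_sub_mul_exp hu0 hu
  have hE : 0 < Real.exp (2 * (1 / s) ^ 2) := Real.exp_pos _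
  calc Real.exp (-(1 / s) - 2 * (1 / s) ^ 2)
        = Real.exp (-(1 / s)) / Real.exp (2 * (1 / s) ^ 2) := by
        rw [← Real.exp_sub]
    _ ≤ (1 - 1 / s) * Real.exp (2 * (1 / s) ^ 2) / Real.exp (2 * (1 / s) ^ 2) :=
        div_le_div_of_nonneg_right h hE.le
    _ = 1 - 1 / s := by rw [mul_div_assoc, div_self hE.ne', mul_one]

/-- **Upper bound** (Chebyshev–Mertens): if `2 ≤ log^{20} x ≤ z` then
`σ ≤ exp(6/log(log^{20} x)) · log(log^{20} x)/log z`.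
[cite: FordGreenKonyaginMaynardTao2018, (6.8) p. 17] -/
theorem sigma_le_exp {x : ℕ} (hL2 : 2 ≤ (Real.log x) ^ 20) (hLz : (Real.log x) ^ 20 ≤ zSieve x) :
    sigma x ≤ Real.exp (6 / Real.log ((Real.log x) ^ 20)) *
      (Real.log ((Real.log x) ^ 20) / Real.log (zSieve x)) := by
  set L := (Real.log x) ^ 20 with hLdef
  set z := zSieve x with hzdef
  have hlogL : 0 < Real.log L := Real.log_pos (by linarith)
  have hlogz : 0 < Real.log z := Real.log_pos (by linarith)
  have htail := LFunctions.MertensBound.loglog_sub_loglog_le_sum_inv_prime hL2 hLz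
  rw [← primesS_eq_Ioc_filter] at htail
  calc sigma x = ∏ s ∈ primesS x, (1 - 1 / (s : ℝ)) := rfl
    _ ≤ ∏ s ∈ primesS x, Real.exp (-(1 / (s : ℝ))) := by
        refine Finset.prod_le_prod (fun s hs => ?_) fun s _ => Real.one_sub_le_exp_neg _
        have h2 := two_le_of_mem_primesS hs
        have : 1 / (s : ℝ) ≤ 1 / 2 := by
          rw [div_le_div_iff₀ (by linarith) (by norm_num)]; linarith
        linarith
    _ = Real.exp (-∑ s ∈ primesS x, 1 / (s : ℝ)) := by
        rw [← Finset.sum_neg_distrib, Real.exp_sum]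
    _ ≤ Real.exp (-(Real.log (Real.log z) - Real.log (Real.log L) - 6 / Real.log L)) :=
        Real.exp_le_exp.mpr (neg_le_neg htail)
    _ = Real.exp (6 / Real.log L) * (Real.log L / Real.log z) := by
        rw [show -(Real.log (Real.log z) - Real.log (Real.log L) - 6 / Real.log L) =
          6 / Real.log L + Real.log (Real.log L) - Real.log (Real.log z) by ring,
          Real.exp_sub, Real.exp_add, Real.exp_log hlogL, Real.exp_log hlogz]
        ring

/-- `Σ_{s ∈ 𝒮} 1/s² ≤ 2/log^{20} x`. [cite: FordGreenKonyaginMaynardTao2018, (6.8) p. 17] -/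
theorem sum_primesS_inv_sq_le {x : ℕ} (hL : 0 < (Real.log x) ^ 20) :
    ∑ s ∈ primesS x, (1 / (s : ℝ)) ^ 2 ≤ 2 / (Real.log x) ^ 20 := by
  set L := (Real.log x) ^ 20 with hLdef
  have hsub : primesS x ⊆ Ioo ⌊L⌋₊ (⌊zSieve x⌋₊ + 1) := by
    intro s hs
    rw [primesS_eq_Ioc_filter, Finset.mem_filter, Finset.mem_Ioc] at hs
    rw [Finset.mem_Ioo]
    exact ⟨hs.1.1, Nat.lt_succ_of_le hs.1.2⟩
  calc ∑ s ∈ primesS x, (1 / (s : ℝ)) ^ 2 ≤ ∑ s ∈ Ioo ⌊L⌋₊ (⌊zSieve x⌋₊ + 1), (1 / (s : ℝ)) ^ 2 :=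
        Finset.sum_le_sum_of_subset_of_nonneg hsub fun s _ _ => by positivity
    _ = ∑ s ∈ Ioo ⌊L⌋₊ (⌊zSieve x⌋₊ + 1), ((s : ℝ) ^ 2)⁻¹ :=
        Finset.sum_congr rfl fun s _ => by rw [one_div, inv_pow]
    _ ≤ 2 / ((⌊L⌋₊ : ℝ) + 1) := sum_Ioo_inv_sq_le _ _
    _ ≤ 2 / L := div_le_div_of_nonneg_left (by norm_num) hL (Nat.lt_floor_add_one L).le

/-- **Lower bound** (Chebyshev–Mertens): if `2 ≤ log^{20} x ≤ z` then
`exp(−(8/log z + 8/log(log^{20} x) + 4/log^{20} x)) · log(log^{20} x)/log z ≤ σ`.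
[cite: FordGreenKonyaginMaynardTao2018, (6.8) p. 17] -/
theorem exp_le_sigma {x : ℕ} (hL2 : 2 ≤ (Real.log x) ^ 20) (hLz : (Real.log x) ^ 20 ≤ zSieve x) :
    Real.exp (-(8 / Real.log (zSieve x) + 8 / Real.log ((Real.log x) ^ 20) + 4 / (Real.log x) ^ 20)) *
      (Real.log ((Real.log x) ^ 20) / Real.log (zSieve x)) ≤ sigma x := by
  set L := (Real.log x) ^ 20 with hLdef
  set z := zSieve x with hzdef
  have hL0 : 0 < L := by linarith
  have hlogL : 0 < Real.log L := Real.log_pos (by linarith)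
  have hlogz : 0 < Real.log z := Real.log_pos (by linarith)
  -- the window upper bound for `Σ 1/s`
  have hwin := LFunctions.SiegelZero.sum_inv_prime_window_le hL2 hLz
  rw [← primesS_eq_primesLE_filter] at hwin
  have hwin' : ∑ s ∈ primesS x, 1 / (s : ℝ) ≤
      Real.log (Real.log z) - Real.log (Real.log L) + 8 / Real.log z + 8 / Real.log L := by
    simpa only [one_div] using hwin
  have hsq := sum_primesS_inv_sq_le (x := x) hL0
  calc Real.exp (-(8 / Real.log z + 8 / Real.log L + 4 / L)) * (Real.log L / Real.log z)
        = Real.exp (-(Real.log (Real.log z) - Real.log (Real.log L) + 8 / Real.log z + 8 / Real.log L)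
            - 2 * (2 / L)) := by
        rw [show -(Real.log (Real.log z) - Real.log (Real.log L) + 8 / Real.log z + 8 / Real.log L)
            - 2 * (2 / L) = -(8 / Real.log z + 8 / Real.log L + 4 / L)
              + (Real.log (Real.log L) - Real.log (Real.log z)) by ring,
          Real.exp_add, Real.exp_sub, Real.exp_log hlogL, Real.exp_log hlogz]
    _ ≤ Real.exp (-(∑ s ∈ primesS x, 1 / (s : ℝ)) - 2 * ∑ s ∈ primesS x, (1 / (s : ℝ)) ^ 2) :=
        Real.exp_le_exp.mpr (by linarith)
    _ = ∏ s ∈ primesS x, Real.exp (-(1 / (s : ℝ)) - 2 * (1 / (s : ℝ)) ^ 2) := by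
        rw [← Real.exp_sum]
        congr 1
        rw [Finset.mul_sum, ← Finset.sum_neg_distrib, ← Finset.sum_sub_distrib]
    _ ≤ ∏ s ∈ primesS x, (1 - 1 / (s : ℝ)) :=
        Finset.prod_le_prod (fun s _ => (Real.exp_pos _).le)
          fun s hs => exp_neg_inv_sub_le (two_le_of_mem_primesS hs)
    _ = sigma x := rfl

/-! ### Growth bookkeeping and the asymptotic form -/

/-- The eventual inequalities between `log x`, `log₂ x`, `log₃ x` used below.
[cite: FordGreenKonyaginMaynardTao2018, §6 p. 17] -/
theorem sigma_growth : ∀ᶠ x : ℕ in atTop,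
    2 ≤ Real.log x ∧ 1 ≤ Real.log (Real.log x) ∧ 1 ≤ Real.log (Real.log (Real.log x)) ∧
      81 * (Real.log (Real.log x)) ^ 2 ≤ Real.log x := by
  have hℓ : Tendsto (fun x : ℕ => Real.log x) atTop atTop :=
    Real.tendsto_log_atTop.comp tendsto_natCast_atTop_atTop
  have hℓ₂ : Tendsto (fun x : ℕ => Real.log (Real.log x)) atTop atTop :=
    Real.tendsto_log_atTop.comp hℓ
  have hℓ₃ : Tendsto (fun x : ℕ => Real.log (Real.log (Real.log x))) atTop atTop :=
    Real.tendsto_log_atTop.comp hℓ₂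
  have hA : ∀ᶠ x : ℕ in atTop, 81 * (Real.log (Real.log x)) ^ 2 ≤ Real.log x := by
    have h := (isLittleO_log_rpow_atTop (show (0 : ℝ) < 1 / 2 by norm_num)).bound
      (show (0 : ℝ) < 1 / 9 by norm_num)
    filter_upwards [hℓ.eventually h, hℓ.eventually_ge_atTop 0, hℓ₂.eventually_ge_atTop 0]
      with x hx hL0 hL20
    have h1 : Real.log (Real.log (x : ℝ)) ≤ 1 / 9 * Real.log (x : ℝ) ^ ((1 : ℝ) / 2) := by
      have h1 := hx
      simp only [Real.norm_eq_abs] at h1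
      rw [abs_of_nonneg hL20, abs_of_nonneg (Real.rpow_nonneg hL0 _)] at h1
      exact h1
    have h2 : (Real.log (x : ℝ) ^ ((1 : ℝ) / 2)) ^ 2 = Real.log x := by
      rw [← Real.rpow_natCast, ← Real.rpow_mul hL0]; norm_num
    calc 81 * (Real.log (Real.log (x : ℝ))) ^ 2 ≤ 81 * (1 / 9 * Real.log (x : ℝ) ^ ((1 : ℝ) / 2)) ^ 2 := by
          gcongr
      _ = Real.log x := by rw [mul_pow, h2]; ring
  filter_upwards [hℓ.eventually_ge_atTop 2, hℓ₂.eventually_ge_atTop 1, hℓ₃.eventually_ge_atTop 1, hA]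
    with x h1 h2 h3 h4
  exact ⟨h1, h2, h3, h4⟩

/-- From the growth facts: `2 ≤ log^{20} x ≤ z` and `log z ≥ 20 log₂ x`.
[cite: FordGreenKonyaginMaynardTao2018, (3.2)–(3.3)] -/
theorem L_le_z_of_growth {x : ℕ} (h1 : 2 ≤ Real.log x) (h2 : 1 ≤ Real.log (Real.log x))
    (h3 : 1 ≤ Real.log (Real.log (Real.log x)))
    (h4 : 81 * (Real.log (Real.log x)) ^ 2 ≤ Real.log x) :
    2 ≤ (Real.log x) ^ 20 ∧ (Real.log x) ^ 20 ≤ zSieve x ∧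
      20 * Real.log (Real.log x) ≤ Real.log (zSieve x) ∧
      Real.log ((Real.log x) ^ 20) = 20 * Real.log (Real.log x) := by
  have hx1 : (1 : ℝ) < x := by
    by_contra h
    push Not at h
    have : Real.log (x : ℝ) ≤ 0 := Real.log_nonpos (Nat.cast_nonneg x) h
    linarith
  have hx0 : (0 : ℝ) < x := by linarith
  have hL2 : 2 ≤ (Real.log x) ^ 20 := by
    calc (2 : ℝ) ≤ 2 ^ 20 := by norm_num
      _ ≤ (Real.log x) ^ 20 := pow_le_pow_left₀ (by norm_num) h1 20
  have hlogL : Real.log ((Real.log x) ^ 20) = 20 * Real.log (Real.log x) := by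
    rw [Real.log_pow]; push_cast; ring
  have hlogz : Real.log (zSieve x) = Real.log (Real.log (Real.log x)) / (4 * Real.log (Real.log x)) *
      Real.log x := by
    rw [zSieve, Real.log_rpow hx0, iter_two, iter_three]
  have h20 : 20 * Real.log (Real.log x) ≤ Real.log (zSieve x) := by
    rw [hlogz, div_mul_eq_mul_div, le_div_iff₀ (by linarith)]
    -- 80 log₂² ≤ log₃ · log x
    have : 80 * (Real.log (Real.log x)) ^ 2 ≤ Real.log (Real.log (Real.log x)) * Real.log x := by
      calc 80 * (Real.log (Real.log x)) ^ 2 ≤ 81 * (Real.log (Real.log x)) ^ 2 := by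
            gcongr; norm_num
        _ ≤ Real.log x := h4
        _ = 1 * Real.log x := (one_mul _).symm
        _ ≤ Real.log (Real.log (Real.log x)) * Real.log x :=
            mul_le_mul_of_nonneg_right h3 (by linarith)
    nlinarith
  refine ⟨hL2, ?_, h20, hlogL⟩
  have hzpos : 0 < zSieve x := Real.rpow_pos_of_pos hx0 _
  rw [← Real.log_le_log_iff (by linarith) hzpos, hlogL]
  exact h20

/-- **(6.8), asymptotic form with rate**: eventually
`sigmaMain x · e^{−1/log₂ x} ≤ σ(x) ≤ sigmaMain x · e^{1/log₂ x}`.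
[cite: FordGreenKonyaginMaynardTao2018, (6.8) p. 17] -/
theorem sigma_bounds : ∀ᶠ x : ℕ in atTop,
    sigmaMain x * Real.exp (-(1 / Real.log^[2] x)) ≤ sigma x ∧
      sigma x ≤ sigmaMain x * Real.exp (1 / Real.log^[2] x) := by
  filter_upwards [sigma_growth] with x hx
  obtain ⟨h1, h2, h3, h4⟩ := hx
  obtain ⟨hL2, hLz, h20, hlogL⟩ := L_le_z_of_growth h1 h2 h3 h4
  have hx1 : 1 < x := by
    by_contra h
    push Not at h
    have : Real.log (x : ℝ) ≤ 0 := Real.log_nonpos (Nat.cast_nonneg x) (by exact_mod_cast h)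
    linarith
  have hℓ₂ne : Real.log^[2] (x : ℝ) ≠ 0 := by rw [iter_two]; linarith
  have hmain : Real.log ((Real.log x) ^ 20) / Real.log (zSieve x) = sigmaMain x :=
    log_L_div_log_z hx1 hℓ₂ne
  have hmain0 : 0 ≤ sigmaMain x := by
    rw [← hmain]; exact div_nonneg (by rw [hlogL]; linarith) (by linarith)
  set ℓ₂ := Real.log (Real.log x) with hℓ₂def
  have hℓ₂pos : 0 < ℓ₂ := by linarith
  rw [iter_two, ← hℓ₂def]
  constructor
  · -- lower
    have h := exp_le_sigma hL2 hLz
    rw [hmain, hlogL] at h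
    refine le_trans ?_ h
    rw [mul_comm]
    refine mul_le_mul_of_nonneg_right (Real.exp_le_exp.mpr ?_) hmain0
    -- 8/log z + 8/(20 ℓ₂) + 4/L ≤ 1/ℓ₂
    have ha : 8 / Real.log (zSieve x) ≤ 8 / (20 * ℓ₂) :=
      div_le_div_of_nonneg_left (by norm_num) (by positivity) h20
    have hb : 4 / (Real.log x) ^ 20 ≤ 4 / (20 * ℓ₂) := by
      refine div_le_div_of_nonneg_left (by norm_num) (by positivity) ?_
      -- 20 ℓ₂ ≤ 20 log x ≤ (log x)^20
      have hlx : ℓ₂ ≤ Real.log x := by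
        rw [hℓ₂def]
        have := Real.log_le_sub_one_of_pos (show 0 < Real.log (x : ℝ) by linarith)
        linarith
      have hpow : 20 * Real.log x ≤ (Real.log x) ^ 20 := by
        have h19 : (2 : ℝ) ^ 19 ≤ (Real.log x) ^ 19 := pow_le_pow_left₀ (by norm_num) h1 19
        calc 20 * Real.log x ≤ 2 ^ 19 * Real.log x := by
              apply mul_le_mul_of_nonneg_right (by norm_num) (by linarith)
          _ ≤ (Real.log x) ^ 19 * Real.log x := mul_le_mul_of_nonneg_right h19 (by linarith)
          _ = (Real.log x) ^ 20 := by ring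
      linarith
    have hsum : 8 / (20 * ℓ₂) + 8 / (20 * ℓ₂) + 4 / (20 * ℓ₂) = 1 / ℓ₂ := by
      field_simp; norm_num
    linarith
  · -- upper
    have h := sigma_le_exp hL2 hLz
    rw [hmain, hlogL] at h
    refine h.trans ?_
    rw [mul_comm]
    refine mul_le_mul_of_nonneg_left (Real.exp_le_exp.mpr ?_) hmain0
    rw [div_le_div_iff₀ (by positivity) hℓ₂pos]
    linarith

/-- **(6.8)′**: for every `ε > 0`, eventually `(1 − ε) sigmaMain x ≤ σ(x) ≤ (1 + ε) sigmaMain x`,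
i.e. `σ = (1 + o(1)) 80 log₂² x / (log x log₃ x)`. [cite: FordGreenKonyaginMaynardTao2018, (6.8) p. 17] -/
theorem sigma_asymp {ε : ℝ} (hε : 0 < ε) : ∀ᶠ x : ℕ in atTop,
    (1 - ε) * sigmaMain x ≤ sigma x ∧ sigma x ≤ (1 + ε) * sigmaMain x := by
  have hℓ : Tendsto (fun x : ℕ => Real.log x) atTop atTop :=
    Real.tendsto_log_atTop.comp tendsto_natCast_atTop_atTop
  have hℓ₂ : Tendsto (fun x : ℕ => Real.log (Real.log x)) atTop atTop :=
    Real.tendsto_log_atTop.comp hℓ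
  have he : Tendsto (fun x : ℕ => 1 / Real.log (Real.log x)) atTop (nhds 0) :=
    tendsto_const_nhds.div_atTop hℓ₂
  have hexp : Tendsto (fun x : ℕ => Real.exp (1 / Real.log (Real.log x))) atTop (nhds 1) := by
    have h0 := (Real.continuous_exp.tendsto 0).comp he
    rw [Real.exp_zero] at h0
    exact h0
  have he' : Tendsto (fun x : ℕ => -(1 / Real.log (Real.log x))) atTop (nhds 0) := by
    simpa using he.neg
  have hexp' : Tendsto (fun x : ℕ => Real.exp (-(1 / Real.log (Real.log x)))) atTop (nhds 1) := by
    have h0 := (Real.continuous_exp.tendsto 0).comp he'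
    rw [Real.exp_zero] at h0
    exact h0
  have hup : ∀ᶠ x : ℕ in atTop, Real.exp (1 / Real.log (Real.log x)) ≤ 1 + ε :=
    hexp.eventually (eventually_le_nhds (show (1 : ℝ) < 1 + ε by linarith))
  have hlo : ∀ᶠ x : ℕ in atTop, 1 - ε ≤ Real.exp (-(1 / Real.log (Real.log x))) :=
    hexp'.eventually (eventually_ge_nhds (show 1 - ε < (1 : ℝ) by linarith))
  have hmain0 : ∀ᶠ x : ℕ in atTop, 0 ≤ sigmaMain x := by
    filter_upwards [sigma_growth] with x hx
    obtain ⟨h1, h2, h3, _⟩ := hx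
    rw [sigmaMain, iter_two, iter_three]
    exact div_nonneg (by positivity) (mul_nonneg (by linarith) (by linarith))
  filter_upwards [sigma_bounds, hup, hlo, hmain0] with x hb hu hl hm
  rw [iter_two] at hb
  constructor
  · calc (1 - ε) * sigmaMain x ≤ Real.exp (-(1 / Real.log (Real.log x))) * sigmaMain x :=
          mul_le_mul_of_nonneg_right hl hm
      _ = sigmaMain x * Real.exp (-(1 / Real.log (Real.log x))) := mul_comm _ _
      _ ≤ sigma x := hb.1
  · calc sigma x ≤ sigmaMain x * Real.exp (1 / Real.log (Real.log x)) := hb.2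
      _ = Real.exp (1 / Real.log (Real.log x)) * sigmaMain x := mul_comm _ _
      _ ≤ (1 + ε) * sigmaMain x := mul_le_mul_of_nonneg_right hu hm

/-- `sigmaMain x · y = 80 c x log₂ x` (the identity behind (6.9)).
[cite: FordGreenKonyaginMaynardTao2018, (6.9) p. 17] -/
theorem sigmaMain_mul_ySieve {x : ℕ} (hℓ : Real.log x ≠ 0) (hℓ₂ : Real.log^[2] x ≠ 0)
    (hℓ₃ : Real.log^[3] x ≠ 0) (c : ℝ) :
    sigmaMain x * ySieve c x = 80 * c * x * Real.log^[2] x := by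
  rw [sigmaMain, ySieve]
  field_simp

/-- **(6.9)**: for every `ε > 0`, eventually (in `x`, uniformly in `c > 0`)
`(1 − ε) 80 c x log₂ x ≤ σ y ≤ (1 + ε) 80 c x log₂ x`.
[cite: FordGreenKonyaginMaynardTao2018, (6.9) p. 17] -/
theorem sigma_mul_ySieve_asymp {ε : ℝ} (hε : 0 < ε) : ∀ᶠ x : ℕ in atTop, ∀ c : ℝ, 0 < c →
    (1 - ε) * (80 * c * x * Real.log^[2] x) ≤ sigma x * ySieve c x ∧
      sigma x * ySieve c x ≤ (1 + ε) * (80 * c * x * Real.log^[2] x) := by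
  filter_upwards [sigma_asymp hε, sigma_growth] with x hx hg c hc
  obtain ⟨h1, h2, h3, _⟩ := hg
  have hℓ : Real.log (x : ℝ) ≠ 0 := by linarith
  have hℓ₂ : Real.log^[2] (x : ℝ) ≠ 0 := by rw [iter_two]; linarith
  have hℓ₃ : Real.log^[3] (x : ℝ) ≠ 0 := by rw [iter_three]; linarith
  have hid := sigmaMain_mul_ySieve hℓ hℓ₂ hℓ₃ c
  have hy : 0 ≤ ySieve c x := by
    rw [ySieve, iter_two, iter_three]
    have hx0 : (0 : ℝ) ≤ x := Nat.cast_nonneg x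
    exact mul_nonneg hc.le (div_nonneg (mul_nonneg (mul_nonneg hx0 (by linarith)) (by linarith))
      (by linarith))
  constructor
  · calc (1 - ε) * (80 * c * x * Real.log^[2] x) = (1 - ε) * sigmaMain x * ySieve c x := by
          rw [← hid]; ring
      _ ≤ sigma x * ySieve c x := mul_le_mul_of_nonneg_right hx.1 hy
  · calc sigma x * ySieve c x ≤ (1 + ε) * sigmaMain x * ySieve c x :=
          mul_le_mul_of_nonneg_right hx.2 hy
      _ = (1 + ε) * (80 * c * x * Real.log^[2] x) := by rw [← hid]; ring

end FGKMT2018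

end Literature.NumberTheory.Sieve
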